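import Mathlib
import Summits.AtomisticToContinuum.HydrodynamicLimit.Theorems.ImplosionDichotomyDenseExcursionPackingResolventInnerAlgebra

/-!
# The packing-order resolvent in the acoustic (inner) variables, part B: the remaining coefficient bounds
# (crux `DenseExcursion`, stmt-AtomisticToContinuum-12586, line `sonic-cavity-renewal` v8, stub `stub_packingResolventW`)

Helper file (`--supports stmt-AtomisticToContinuum-12586`) for the registered stub `stub_packingResolventW` (skeleton v8)
of the line `sonic-cavity-renewal`: the PURE ALGEBRA and the PURE REAL ARITHMETIC of the inner (acoustic) region of the
barrier a-priori estimate behind the `(1 + S)`-weighted Laplace gain (registered helper `packingResolventW_innerCoeff`).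

**The inner variables.** Near the centre the real resolvent system `Λu − Lu = f` (`L = (linW, linS)`, real `Λ = kμ`
large, source `(f₁, f₂)`) is NOT a weakly coupled pair of transport equations (the acoustic layer at `R = eˣ ≍ s₀/Λ`,
wave-3 finding of this line), but in the variables `u₁` and `V := (Λ/s₀²)·e^{2x}·S·u₂` it is a regular `O(1/Λ)`
perturbation of the forced modified-spherical-Bessel system `u₁′ = −3u₁ + 3V − 3g`, `V′ = (ρ²/3)u₁`, `ρ = Λeˣ/s₀`,
`g = f₂/S`:

* `inner_normal_form` (Cramer, determinant `S² − (1 − W)²`, stated without division): the exact normal form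
  `u₁′ = a₁₁u₁ + a₁₂V + h₁`, `V′ = a₂₁u₁ + a₂₂V + h₂`, the six coefficients characterised by polynomial identities;
* `inner_a11_bound`, …, `inner_h2_bound`: on `x ≤ x_Λ = log(2s₀/Λ)`, `Λ ≥ 1000` (`δ = 1/Λ`), with the centre expansion of
  the cavity tube simplified by `inner_atoms_small` to the atoms `|W − (r−1)|, |W′|, |eˣS − s₀|, |(eˣS)′| ≤ δ²`,
  `7/10 ≤ eˣS ≤ 1`, `eˣ ≤ 2δ`: `|a₁₁ + 3| ≤ 8δ`, `|a₁₂ − 3| ≤ δ/10`, `|a₂₁ − ρ²/3| ≤ (2/3)ρ²δ`, `0 ≤ a₂₂ ≤ (9/10)ρ²δ`,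
  `|h₁| ≤ (301/100)N`, `|h₂| ≤ N(17ρ/50 + ρ²/100)` for sources with `|f₁| ≤ N(1 + S)`, `|f₂| ≤ NS`.

Elementary (ring identities and explicit inequalities); the wave-4 worker's numerics on `SS(r₂)` (`validate_barrier.py`:
`Λ|a₁₁ + 3| ≤ 3.55`, `Λ²|a₁₂ − 3| ≤ 9.0`, `Λ|a₂₁ − ρ²/3|/ρ² ≤ 0.591`, `Λa₂₂/ρ² ≤ 0.887`) sit inside the constants.
NOT here: any function, derivative or profile — only real numbers at one point `x ≤ x_Λ`.
-/

namespace Summit.AtomisticToContinuum.HydrodynamicLimit.Theorems.PackingAnalyticImplosion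

open Literature.Analysis.FluidPDE.CompressibleEuler (abs_mul_le_of_le)

/-- `|a₂₁ − ρ²/3| ≤ (2/3)ρ²δ`: `(a₂₁ − ρ²/3)s₀²(s̃² − (1−w)²e²) = Λe²·Q`, `Q = Λ(1−w)²e²/3 − s̃²(b₁/3 + (1−w)) − (1−w)s̃(eˣS)′`,
`b₁/3 + (1−w) ≈ (4 − 2r)/3 ∈ [0.589, 0.596]`, `Λe² = ρ²s₀²δ`. [folklore] -/
theorem inner_a21_bound {Λ δ r w w' S S' e s₀ ρ a₂₁ : ℝ} (hδΛ : δ * Λ = 1) (hδ : 0 < δ) (hδ' : δ ≤ 1 / 1000)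
    (he : 0 < e) (he2 : e ≤ 2 * δ) (hs₀ : 7 / 10 ≤ s₀) (hρ : ρ * s₀ = Λ * e)
    (hst1 : 7 / 10 ≤ S * e) (hst2 : S * e ≤ 1)
    (hsd : |e * (S + S')| ≤ δ ^ 2) (hw : |w - (r - 1)| ≤ δ ^ 2) (hw' : |w'| ≤ δ ^ 2)
    (hr1 : 17307 / 15625 ≤ r) (hr2 : r ≤ 697 / 625)
    (ha21 : a₂₁ * (s₀ ^ 2 * (S ^ 2 - (1 - w) ^ 2)) =
      Λ * e ^ 2 * S * (Λ * S / 3 - (w' + 2 * w - r) * S / 3 - (1 - w) * (2 * S + S'))) :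
    |a₂₁ - ρ ^ 2 / 3| ≤ 2 / 3 * ρ ^ 2 * δ := by
  obtain ⟨hδ2, hE, ⟨hw1, hw2⟩, hwe, hP, -⟩ := inner_basic hδ hδ' he he2 hst1 hst2 hw hr1 hr2
  obtain ⟨hwl, hwu⟩ := abs_le.1 hw
  obtain ⟨hw'l, hw'u⟩ := abs_le.1 hw'
  have hΛ : 1000 ≤ Λ := thousand_le_of_delta hδΛ hδ hδ'
  have hΛE : Λ * e ^ 2 ≤ 4 * δ := by
    calc Λ * e ^ 2 ≤ Λ * (4 * δ ^ 2) := mul_le_mul_of_nonneg_left hE (by linarith)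
      _ = 4 * δ * (δ * Λ) := by ring
      _ = 4 * δ := by rw [hδΛ, mul_one]
  set P : ℝ := (S * e) ^ 2 - (1 - w) ^ 2 * e ^ 2 with hP_def
  set Q : ℝ := Λ * ((1 - w) ^ 2 * e ^ 2) / 3 + -((S * e) ^ 2 * ((w' + 2 * w - r) / 3 + (1 - w)))
    + -((1 - w) * (S * e) * (e * (S + S'))) with hQ_def
  have key : (a₂₁ - ρ ^ 2 / 3) * (s₀ ^ 2 * P) = Λ * e ^ 2 * Q := by
    rw [hP_def, hQ_def]
    linear_combination e ^ 2 * ha21 + (-(ρ * s₀ + Λ * e) * ((S * e) ^ 2 - (1 - w) ^ 2 * e ^ 2) / 3) * hρ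
  have hQ : |Q| ≤ 2 / 3 * P := by
    have t1 : |Λ * ((1 - w) ^ 2 * e ^ 2) / 3| ≤ 4 / 3 * δ := by
      rw [abs_of_nonneg (by positivity)]
      have : Λ * ((1 - w) ^ 2 * e ^ 2) ≤ Λ * (4 * δ ^ 2) := mul_le_mul_of_nonneg_left hwe (by linarith)
      have h2 : Λ * (4 * δ ^ 2) = 4 * δ * (δ * Λ) := by ring
      rw [h2, hδΛ, mul_one] at this
      linarith
    have t2 : |(-((S * e) ^ 2 * ((w' + 2 * w - r) / 3 + (1 - w))))| ≤ (S * e) ^ 2 * (596 / 1000) := by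
      rw [abs_neg, abs_mul, abs_of_nonneg (by positivity : (0:ℝ) ≤ (S * e) ^ 2)]
      refine mul_le_mul_of_nonneg_left ?_ (by positivity)
      rw [abs_le]; constructor <;> linarith
    have t3 : |(-((1 - w) * (S * e) * (e * (S + S'))))| ≤ 9 / 10 * 1 * δ ^ 2 := by
      rw [abs_neg]
      exact abs_mul_le_of_le (abs_mul_le_of_le (by rw [abs_le]; constructor <;> linarith)
        (by rw [abs_le]; constructor <;> linarith)) hsd
    have hsum := abs_add_three (Λ * ((1 - w) ^ 2 * e ^ 2) / 3) (-((S * e) ^ 2 * ((w' + 2 * w - r) / 3 + (1 - w))))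
      (-((1 - w) * (S * e) * (e * (S + S'))))
    rw [← hQ_def] at hsum
    have hst : 49 / 100 ≤ (S * e) ^ 2 := by
      calc (49 / 100 : ℝ) = (7 / 10) ^ 2 := by norm_num
        _ ≤ (S * e) ^ 2 := pow_le_pow_left₀ (by norm_num) hst1 2
    have hPl : (S * e) ^ 2 - 4 * δ ^ 2 ≤ P := by rw [hP_def]; linarith
    linarith
  have hΛe : Λ * e ^ 2 = ρ ^ 2 * s₀ ^ 2 * δ := by
    have h1 : ρ ^ 2 * s₀ ^ 2 = Λ ^ 2 * e ^ 2 := by rw [← mul_pow, hρ, mul_pow]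
    calc Λ * e ^ 2 = Λ ^ 2 * e ^ 2 * δ := by
          calc Λ * e ^ 2 = Λ * e ^ 2 * (δ * Λ) := by rw [hδΛ, mul_one]
            _ = Λ ^ 2 * e ^ 2 * δ := by ring
      _ = ρ ^ 2 * s₀ ^ 2 * δ := by rw [← h1]
  have hsP : 0 < s₀ ^ 2 * P := by positivity
  have h1 : |a₂₁ - ρ ^ 2 / 3| * (s₀ ^ 2 * P) ≤ 2 / 3 * ρ ^ 2 * δ * (s₀ ^ 2 * P) := by
    have h2 : |(a₂₁ - ρ ^ 2 / 3) * (s₀ ^ 2 * P)| = Λ * e ^ 2 * |Q| := by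
      rw [key, abs_mul, abs_of_nonneg (by positivity : (0:ℝ) ≤ Λ * e ^ 2)]
    rw [abs_mul, abs_of_pos hsP] at h2
    rw [h2, hΛe]
    calc ρ ^ 2 * s₀ ^ 2 * δ * |Q| ≤ ρ ^ 2 * s₀ ^ 2 * δ * (2 / 3 * P) := mul_le_mul_of_nonneg_left hQ (by positivity)
      _ = 2 / 3 * ρ ^ 2 * δ * (s₀ ^ 2 * P) := by ring
  exact le_of_mul_le_mul_right h1 hsP

/-- The arithmetic of `inner_a22_bound`, on opaque atoms `st = eˣS`, `P = st² − (1−w)²e²`, `B`. [folklore] -/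
theorem inner_a22_arith {Λ δ w e st P B s₀ ρ a₂₂ : ℝ} (hδ : 0 < δ) (hδ' : δ ≤ 1 / 1000) (hΛ : 1000 ≤ Λ)
    (he : 0 < e) (hst1 : 7 / 10 ≤ st) (hst2 : st ≤ 1) (hP : 48 / 100 ≤ P) (hPl : st ^ 2 - 4 * δ ^ 2 ≤ P)
    (hw1 : 88 / 100 ≤ 1 - w) (hw2 : 1 - w ≤ 8924 / 10000) (hs₀ : 7 / 10 ≤ s₀) (hs0u : s₀ ≤ st + δ ^ 2)
    (hB1 : st * (Λ - 1) - δ ^ 2 ≤ B) (hB2 : B ≤ st * Λ + 3 * δ ^ 2)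
    (hΛe : Λ * e ^ 2 = ρ ^ 2 * s₀ ^ 2 * δ) (hΛδ2 : Λ * δ ^ 2 = δ)
    (key : a₂₂ * (P * st) = (1 - w) * e ^ 2 * B) : 0 ≤ a₂₂ ∧ a₂₂ ≤ 9 / 10 * ρ ^ 2 * δ := by
  have hB0 : 0 ≤ B := by
    have : 7 / 10 * (1000 - 1) ≤ st * (Λ - 1) := mul_le_mul hst1 (by linarith) (by norm_num) (by positivity)
    nlinarith
  have hPst : 0 < P * st := by positivity
  constructor
  · have h1 : 0 ≤ a₂₂ * (P * st) := by
      rw [key]; have : 0 ≤ 1 - w := by linarith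
      positivity
    exact le_of_mul_le_mul_right (by rwa [zero_mul]) hPst
  · have hs0sq : s₀ ^ 2 ≤ st ^ 2 + 3 * δ ^ 2 := by
      have h1 : st * δ ^ 2 ≤ 1 * δ ^ 2 := mul_le_mul_of_nonneg_right hst2 (by positivity)
      have h2 : δ ^ 2 * δ ^ 2 ≤ 1 * δ ^ 2 := mul_le_mul_of_nonneg_right (by nlinarith) (by positivity)
      calc s₀ ^ 2 ≤ (st + δ ^ 2) ^ 2 := pow_le_pow_left₀ (by linarith) (by linarith) 2
        _ = st ^ 2 + 2 * (st * δ ^ 2) + δ ^ 2 * δ ^ 2 := by ring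
        _ ≤ st ^ 2 + 3 * δ ^ 2 := by linarith
    have hmain : (1 - w) * B * s₀ ^ 2 ≤ 9 / 10 * Λ * P * st := by
      have h2 : (1 - w) * B ≤ 8924 / 10000 * (st * Λ + 3 * δ ^ 2) := mul_le_mul hw2 hB2 hB0 (by norm_num)
      have h3 : (1 - w) * B * s₀ ^ 2 ≤ 8924 / 10000 * (st * Λ + 3 * δ ^ 2) * (st ^ 2 + 3 * δ ^ 2) :=
        mul_le_mul h2 hs0sq (by positivity) (by positivity)
      have h4 : 9 / 10 * Λ * (st ^ 2 - 4 * δ ^ 2) * st ≤ 9 / 10 * Λ * P * st := by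
        apply mul_le_mul_of_nonneg_right _ (by positivity)
        exact mul_le_mul_of_nonneg_left hPl (by positivity)
      have h5 : 8924 / 10000 * (st * Λ + 3 * δ ^ 2) * (st ^ 2 + 3 * δ ^ 2)
          = 8924 / 10000 * (Λ * st ^ 3 + 3 * st * (Λ * δ ^ 2) + 3 * δ ^ 2 * st ^ 2 + 9 * δ ^ 2 * δ ^ 2) := by ring
      have h6 : 9 / 10 * Λ * (st ^ 2 - 4 * δ ^ 2) * st = 9 / 10 * (Λ * st ^ 3) - 36 / 10 * st * (Λ * δ ^ 2) := by ring
      rw [h5, hΛδ2] at h3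
      rw [h6, hΛδ2] at h4
      have hst3 : 343 / 1000 ≤ st ^ 3 := by
        calc (343 / 1000 : ℝ) = (7 / 10) ^ 3 := by norm_num
          _ ≤ st ^ 3 := pow_le_pow_left₀ (by norm_num) hst1 3
      have h7 : 1000 * (343 / 1000) ≤ Λ * st ^ 3 := mul_le_mul hΛ hst3 (by norm_num) (by linarith)
      have h8 : st * δ ≤ 1 * δ := mul_le_mul_of_nonneg_right hst2 hδ.le
      have hst2' : st ^ 2 ≤ 1 := by
        calc st ^ 2 ≤ 1 ^ 2 := pow_le_pow_left₀ (by positivity) hst2 2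
          _ = 1 := by ring
      have h9 : δ ^ 2 * st ^ 2 ≤ δ ^ 2 * 1 := mul_le_mul_of_nonneg_left hst2' (by positivity)
      have h10 : δ ^ 2 * δ ^ 2 ≤ δ ^ 2 * 1 := mul_le_mul_of_nonneg_left (by nlinarith) (by positivity)
      have hδ2 : δ ^ 2 ≤ δ / 1000 := by nlinarith
      linarith
    have h2 : a₂₂ * (P * st * s₀ ^ 2) ≤ 9 / 10 * ρ ^ 2 * δ * (P * st * s₀ ^ 2) := by
      calc a₂₂ * (P * st * s₀ ^ 2) = e ^ 2 * ((1 - w) * B * s₀ ^ 2) := by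
            rw [show a₂₂ * (P * st * s₀ ^ 2) = a₂₂ * (P * st) * s₀ ^ 2 by ring, key]; ring
        _ ≤ e ^ 2 * (9 / 10 * Λ * P * st) := mul_le_mul_of_nonneg_left hmain (by positivity)
        _ = 9 / 10 * (Λ * e ^ 2) * (P * st) := by ring
        _ = 9 / 10 * ρ ^ 2 * δ * (P * st * s₀ ^ 2) := by rw [hΛe]; ring
    exact le_of_mul_le_mul_right h2 (by positivity)

/-- `0 ≤ a₂₂ ≤ (9/10)ρ²δ`: `a₂₂·s̃(s̃² − (1−w)²e²) = (1−w)e²(s̃(Λ + (r−1−w) − w′/3) + (w−1)(eˣS)′)`, `1 − w ≤ 0.8924 < 9/10`,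
`s₀² ≤ s̃² + 3δ²`. [folklore] -/
theorem inner_a22_bound {Λ δ r w w' S S' e s₀ ρ a₂₂ : ℝ} (hδΛ : δ * Λ = 1) (hδ : 0 < δ) (hδ' : δ ≤ 1 / 1000)
    (he : 0 < e) (he2 : e ≤ 2 * δ) (hs₀ : 7 / 10 ≤ s₀) (hρ : ρ * s₀ = Λ * e)
    (hst1 : 7 / 10 ≤ S * e) (hst2 : S * e ≤ 1) (hst0 : |S * e - s₀| ≤ δ ^ 2)
    (hsd : |e * (S + S')| ≤ δ ^ 2) (hw : |w - (r - 1)| ≤ δ ^ 2) (hw' : |w'| ≤ δ ^ 2)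
    (hr1 : 17307 / 15625 ≤ r) (hr2 : r ≤ 697 / 625)
    (ha22 : a₂₂ * ((S ^ 2 - (1 - w) ^ 2) * S) = (1 - w) * (Λ * S + (w - 1) * (2 * S + S') - (w' / 3 + 2 * w - r) * S)) :
    0 ≤ a₂₂ ∧ a₂₂ ≤ 9 / 10 * ρ ^ 2 * δ := by
  obtain ⟨hδ2, hE, ⟨hw1, hw2⟩, hwe, hP, -⟩ := inner_basic hδ hδ' he he2 hst1 hst2 hw hr1 hr2
  obtain ⟨hwl, hwu⟩ := abs_le.1 hw
  obtain ⟨hw'l, hw'u⟩ := abs_le.1 hw'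
  obtain ⟨hsl, hsu⟩ := abs_le.1 hst0
  have hΛ : 1000 ≤ Λ := thousand_le_of_delta hδΛ hδ hδ'
  have key : a₂₂ * (((S * e) ^ 2 - (1 - w) ^ 2 * e ^ 2) * (S * e)) =
      (1 - w) * e ^ 2 * ((S * e) * (Λ + ((r - 1 - w) - w' / 3)) + (w - 1) * (e * (S + S'))) := by
    linear_combination e ^ 3 * ha22
  have hwp : |(w - 1) * (e * (S + S'))| ≤ 1 * δ ^ 2 :=
    abs_mul_le_of_le (by rw [abs_le]; constructor <;> linarith) hsd
  obtain ⟨hwp1, hwp2⟩ := abs_le.1 hwp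
  have hB1 : (S * e) * (Λ - 1) - δ ^ 2 ≤ (S * e) * (Λ + ((r - 1 - w) - w' / 3)) + (w - 1) * (e * (S + S')) := by
    have h1 : (S * e) * (Λ - 1) ≤ (S * e) * (Λ + ((r - 1 - w) - w' / 3)) :=
      mul_le_mul_of_nonneg_left (by linarith) (by positivity)
    linarith
  have hB2 : (S * e) * (Λ + ((r - 1 - w) - w' / 3)) + (w - 1) * (e * (S + S')) ≤ (S * e) * Λ + 3 * δ ^ 2 := by
    have h1 : (S * e) * (Λ + ((r - 1 - w) - w' / 3)) ≤ (S * e) * (Λ + 2 * δ ^ 2) :=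
      mul_le_mul_of_nonneg_left (by linarith) (by positivity)
    have h3 : (S * e) * (2 * δ ^ 2) ≤ 1 * (2 * δ ^ 2) := mul_le_mul_of_nonneg_right hst2 (by positivity)
    linarith
  have hΛe : Λ * e ^ 2 = ρ ^ 2 * s₀ ^ 2 * δ := by
    have h1 : ρ ^ 2 * s₀ ^ 2 = Λ ^ 2 * e ^ 2 := by rw [← mul_pow, hρ, mul_pow]
    calc Λ * e ^ 2 = Λ ^ 2 * e ^ 2 * δ := by
          calc Λ * e ^ 2 = Λ * e ^ 2 * (δ * Λ) := by rw [hδΛ, mul_one]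
            _ = Λ ^ 2 * e ^ 2 * δ := by ring
      _ = ρ ^ 2 * s₀ ^ 2 * δ := by rw [← h1]
  have hΛδ2 : Λ * δ ^ 2 = δ := by
    calc Λ * δ ^ 2 = δ * (δ * Λ) := by ring
      _ = δ := by rw [hδΛ, mul_one]
  have hPl : (S * e) ^ 2 - 4 * δ ^ 2 ≤ (S * e) ^ 2 - (1 - w) ^ 2 * e ^ 2 := by linarith
  exact inner_a22_arith hδ hδ' hΛ he hst1 hst2 hP hPl hw1 hw2 hs₀ (by linarith) hB1 hB2 hΛe hΛδ2 key

/-- `|h₁| ≤ (301/100)N` for sources with `|eˣf₂| ≤ N·s̃`, `|eˣf₁| ≤ N(eˣ + s̃)` (i.e. `|f₂| ≤ NS`, `|f₁| ≤ N(1 + S)`):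
`h₁(s̃² − (1−w)²e²) = −(3s̃(eˣf₂) + (1−w)eˣ(eˣf₁))`. [folklore] -/
theorem inner_h1_bound {δ r w S e F₁ F₂ N h₁ : ℝ} (hδ : 0 < δ) (hδ' : δ ≤ 1 / 1000)
    (he : 0 < e) (he2 : e ≤ 2 * δ) (hst1 : 7 / 10 ≤ S * e) (hst2 : S * e ≤ 1) (hw : |w - (r - 1)| ≤ δ ^ 2)
    (hr1 : 17307 / 15625 ≤ r) (hr2 : r ≤ 697 / 625) (hN : 0 ≤ N)
    (hF₁ : |e * F₁| ≤ N * (e + S * e)) (hF₂ : |e * F₂| ≤ N * (S * e))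
    (hh1 : h₁ * (S ^ 2 - (1 - w) ^ 2) = -(3 * S * F₂ + (1 - w) * F₁)) : |h₁| ≤ 301 / 100 * N := by
  obtain ⟨hδ2, hE, ⟨hw1, hw2⟩, hwe, hP, -⟩ := inner_basic hδ hδ' he he2 hst1 hst2 hw hr1 hr2
  set st : ℝ := S * e with hst_def
  set P : ℝ := st ^ 2 - (1 - w) ^ 2 * e ^ 2 with hP_def
  have key : h₁ * P = -(3 * st) * (e * F₂) + -((1 - w) * e) * (e * F₁) + 0 := by
    rw [hP_def, hst_def]; linear_combination e ^ 2 * hh1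
  have t1 : |-(3 * st) * (e * F₂)| ≤ 3 * st * (N * st) :=
    abs_mul_le_of_le (by rw [abs_neg, abs_of_nonneg (by positivity)]) hF₂
  have t2 : |-((1 - w) * e) * (e * F₁)| ≤ (9 / 10 * e) * (N * (e + st)) := by
    refine abs_mul_le_of_le ?_ hF₁
    rw [abs_neg, abs_mul, abs_of_pos he]
    exact mul_le_mul_of_nonneg_right (by rw [abs_le]; constructor <;> linarith) he.le
  have hnum : |h₁ * P| ≤ 3 * st * (N * st) + 9 / 10 * e * (N * (e + st)) := by
    rw [key]
    refine (abs_add_three _ _ _).trans ?_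
    rw [abs_zero]; linarith
  have hPpos : 0 < P := by linarith
  rw [abs_mul, abs_of_pos hPpos] at hnum
  -- `3 st² N + 0.9 e N (e + st) ≤ 3.01 N P`
  have hcmp : 3 * st * (N * st) + 9 / 10 * e * (N * (e + st)) ≤ 301 / 100 * N * P := by
    have hPl : st ^ 2 - 4 * δ ^ 2 ≤ P := by rw [hP_def]; linarith
    have h1 : 3 * st ^ 2 + 9 / 10 * e * (e + st) ≤ 301 / 100 * (st ^ 2 - 4 * δ ^ 2) := by
      have hee : e * (e + st) ≤ 2 * δ * (2 * δ + 1) := mul_le_mul he2 (by linarith) (by positivity) (by positivity)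
      have hst : 49 / 100 ≤ st ^ 2 := by
        calc (49 / 100 : ℝ) = (7 / 10) ^ 2 := by norm_num
          _ ≤ st ^ 2 := pow_le_pow_left₀ (by norm_num) hst1 2
      nlinarith
    have h2 : N * (3 * st ^ 2 + 9 / 10 * e * (e + st)) ≤ N * (301 / 100 * P) :=
      mul_le_mul_of_nonneg_left (h1.trans (by linarith)) hN
    linarith
  exact le_of_mul_le_mul_right (hnum.trans hcmp) hPpos

/-- The arithmetic of `inner_h2_bound`, on opaque atoms (`X` = the source bracket). [folklore] -/
theorem inner_h2_arith {Λ δ e st P s₀ ρ N X h₂ : ℝ} (hδ : 0 < δ) (hδ' : δ ≤ 1 / 1000)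
    (he : 0 < e) (hst1 : 7 / 10 ≤ st) (hst2 : st ≤ 1) (hP : 48 / 100 ≤ P)
    (hPl : st ^ 2 - 4 * δ ^ 2 ≤ P) (hs₀ : 7 / 10 ≤ s₀) (hs0l : st - δ ^ 2 ≤ s₀) (hρ0 : 0 ≤ ρ) (hN : 0 ≤ N)
    (hΛe : Λ * e ^ 2 = ρ ^ 2 * s₀ ^ 2 * δ) (hρe : ρ * s₀ = Λ * e)
    (hX : |X| ≤ N * st ^ 2 * (37 / 30 * e + st / 3)) (key : h₂ * (s₀ ^ 2 * P) * e = -(Λ * e ^ 2) * X) :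
    |h₂| ≤ N * (17 / 50 * ρ + ρ ^ 2 / 100) := by
  have hsP : 0 < s₀ ^ 2 * P := by positivity
  have hnum : |h₂| * (s₀ ^ 2 * P) * e ≤ Λ * e ^ 2 * (N * st ^ 2 * (37 / 30 * e + st / 3)) := by
    have h1 : |h₂ * (s₀ ^ 2 * P) * e| = Λ * e ^ 2 * |X| := by
      rw [key, abs_mul, abs_neg, abs_of_nonneg (by rw [hΛe]; positivity : (0:ℝ) ≤ Λ * e ^ 2)]
    rw [abs_mul, abs_mul, abs_of_pos hsP, abs_of_pos he] at h1
    rw [h1]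
    exact mul_le_mul_of_nonneg_left hX (by rw [hΛe]; positivity)
  have h2 : |h₂| * (s₀ ^ 2 * P) ≤ Λ * e * (N * st ^ 2 * (37 / 30 * e + st / 3)) := by
    have h3 := hnum
    rw [show Λ * e ^ 2 * (N * st ^ 2 * (37 / 30 * e + st / 3)) =
      Λ * e * (N * st ^ 2 * (37 / 30 * e + st / 3)) * e by ring] at h3
    exact le_of_mul_le_mul_right h3 he
  have hsplit : Λ * e * (N * st ^ 2 * (37 / 30 * e + st / 3)) =
      37 / 30 * (Λ * e ^ 2) * N * st ^ 2 + (Λ * e) * N * st ^ 3 / 3 := by ring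
  have hst2' : st ^ 2 ≤ 1 := by
    calc st ^ 2 ≤ 1 ^ 2 := pow_le_pow_left₀ (by positivity) hst2 2
      _ = 1 := by ring
  -- (A) the `ρ²`-part
  have hA : 37 / 30 * (Λ * e ^ 2) * N * st ^ 2 ≤ N * (ρ ^ 2 / 100) * (s₀ ^ 2 * P) := by
    rw [hΛe]
    have h4 : 37 / 30 * δ * st ^ 2 ≤ P / 100 := by
      have h6 : 37 / 30 * δ * st ^ 2 ≤ 37 / 30 * δ * 1 := mul_le_mul_of_nonneg_left hst2' (by positivity)
      linarith
    have h7 : ρ ^ 2 * s₀ ^ 2 * N * (37 / 30 * δ * st ^ 2) ≤ ρ ^ 2 * s₀ ^ 2 * N * (P / 100) :=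
      mul_le_mul_of_nonneg_left h4 (by positivity)
    have e1 : 37 / 30 * (ρ ^ 2 * s₀ ^ 2 * δ) * N * st ^ 2 = ρ ^ 2 * s₀ ^ 2 * N * (37 / 30 * δ * st ^ 2) := by ring
    have e2 : N * (ρ ^ 2 / 100) * (s₀ ^ 2 * P) = ρ ^ 2 * s₀ ^ 2 * N * (P / 100) := by ring
    rw [e1, e2]; exact h7
  -- (B) the `ρ`-part
  have hB : (Λ * e) * N * st ^ 3 / 3 ≤ N * (17 / 50 * ρ) * (s₀ ^ 2 * P) := by
    rw [← hρe]
    have h4 : st ^ 3 / 3 ≤ 17 / 50 * (s₀ * P) := by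
      have hstsq : 49 / 100 ≤ st ^ 2 := by
        calc (49 / 100 : ℝ) = (7 / 10) ^ 2 := by norm_num
          _ ≤ st ^ 2 := pow_le_pow_left₀ (by norm_num) hst1 2
      have hδ2' : δ ^ 2 ≤ δ / 1000 := by nlinarith
      have h5 : (st - δ ^ 2) * (st ^ 2 - 4 * δ ^ 2) ≤ s₀ * P :=
        mul_le_mul hs0l hPl (by linarith) (by linarith)
      have h6 : st ^ 3 - 5 * δ ^ 2 ≤ (st - δ ^ 2) * (st ^ 2 - 4 * δ ^ 2) := by
        have e1 : (st - δ ^ 2) * (st ^ 2 - 4 * δ ^ 2) = st ^ 3 - 5 * δ ^ 2 + (δ ^ 2 * (4 - 4 * st) + δ ^ 2 * (1 - st ^ 2)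
          + 4 * (δ ^ 2 * δ ^ 2)) := by ring
        rw [e1]
        have h8 : 0 ≤ δ ^ 2 * (4 - 4 * st) := mul_nonneg (by positivity) (by linarith)
        have h9 : 0 ≤ δ ^ 2 * (1 - st ^ 2) := mul_nonneg (by positivity) (by linarith)
        have h10 : 0 ≤ 4 * (δ ^ 2 * δ ^ 2) := by positivity
        linarith
      have hst3 : 343 / 1000 ≤ st ^ 3 := by
        calc (343 / 1000 : ℝ) = (7 / 10) ^ 3 := by norm_num
          _ ≤ st ^ 3 := pow_le_pow_left₀ (by norm_num) hst1 3
      have hδ2 : δ ^ 2 ≤ δ / 1000 := by nlinarith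
      linarith
    have h7 : ρ * s₀ * N * (st ^ 3 / 3) ≤ ρ * s₀ * N * (17 / 50 * (s₀ * P)) :=
      mul_le_mul_of_nonneg_left h4 (by positivity)
    have e1 : ρ * s₀ * N * st ^ 3 / 3 = ρ * s₀ * N * (st ^ 3 / 3) := by ring
    have e2 : N * (17 / 50 * ρ) * (s₀ ^ 2 * P) = ρ * s₀ * N * (17 / 50 * (s₀ * P)) := by ring
    rw [e1, e2]; exact h7
  have hgoal : Λ * e * (N * st ^ 2 * (37 / 30 * e + st / 3)) ≤ N * (17 / 50 * ρ + ρ ^ 2 / 100) * (s₀ ^ 2 * P) := by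
    rw [hsplit]
    have e3 : N * (17 / 50 * ρ + ρ ^ 2 / 100) * (s₀ ^ 2 * P) =
        N * (ρ ^ 2 / 100) * (s₀ ^ 2 * P) + N * (17 / 50 * ρ) * (s₀ ^ 2 * P) := by ring
    rw [e3]; exact add_le_add hA hB
  exact le_of_mul_le_mul_right (h2.trans hgoal) hsP

/-- `|h₂| ≤ N(17ρ/50 + ρ²/100)`: `h₂s₀²(s̃² − (1−w)²e²)·eˣ = −Λe²(s̃(1−w)(e(eˣf₂)) + s̃²(eˣf₁)/3)`, `Λe² = ρ²s₀²δ`,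
`Λe = ρs₀`. [folklore] -/
theorem inner_h2_bound {Λ δ r w S e s₀ ρ F₁ F₂ N h₂ : ℝ} (hδΛ : δ * Λ = 1) (hδ : 0 < δ) (hδ' : δ ≤ 1 / 1000)
    (he : 0 < e) (he2 : e ≤ 2 * δ) (hs₀ : 7 / 10 ≤ s₀) (hρ : ρ * s₀ = Λ * e) (hst1 : 7 / 10 ≤ S * e) (hst2 : S * e ≤ 1)
    (hst0 : |S * e - s₀| ≤ δ ^ 2) (hw : |w - (r - 1)| ≤ δ ^ 2)
    (hr1 : 17307 / 15625 ≤ r) (hr2 : r ≤ 697 / 625) (hN : 0 ≤ N)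
    (hF₁ : |e * F₁| ≤ N * (e + S * e)) (hF₂ : |e * F₂| ≤ N * (S * e))
    (hh2 : h₂ * (s₀ ^ 2 * (S ^ 2 - (1 - w) ^ 2)) = -(Λ * e ^ 2 * S * ((1 - w) * F₂ + S * F₁ / 3))) :
    |h₂| ≤ N * (17 / 50 * ρ + ρ ^ 2 / 100) := by
  obtain ⟨hδ2, hE, ⟨hw1, hw2⟩, hwe, hP, -⟩ := inner_basic hδ hδ' he he2 hst1 hst2 hw hr1 hr2
  obtain ⟨hsl, hsu⟩ := abs_le.1 hst0
  have hΛ : 1000 ≤ Λ := thousand_le_of_delta hδΛ hδ hδ'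
  have hρ0 : 0 ≤ ρ := by
    have : 0 ≤ ρ * s₀ := by rw [hρ]; positivity
    nlinarith
  have key : h₂ * (s₀ ^ 2 * ((S * e) ^ 2 - (1 - w) ^ 2 * e ^ 2)) * e =
      -(Λ * e ^ 2) * (((S * e) * (1 - w)) * (e * (e * F₂)) + ((S * e) ^ 2 / 3) * (e * F₁)) := by
    linear_combination e ^ 3 * hh2
  have hbr : |((S * e) * (1 - w)) * (e * (e * F₂)) + ((S * e) ^ 2 / 3) * (e * F₁)|
      ≤ N * (S * e) ^ 2 * (37 / 30 * e + (S * e) / 3) := by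
    have t1 : |((S * e) * (1 - w)) * (e * (e * F₂))| ≤ ((S * e) * (9 / 10)) * (e * (N * (S * e))) := by
      refine abs_mul_le_of_le ?_ ?_
      · rw [abs_mul, abs_of_nonneg (by positivity : (0:ℝ) ≤ S * e)]
        exact mul_le_mul_of_nonneg_left (by rw [abs_le]; constructor <;> linarith) (by positivity)
      · rw [abs_mul, abs_of_pos he]; exact mul_le_mul_of_nonneg_left hF₂ he.le
    have t2 : |((S * e) ^ 2 / 3) * (e * F₁)| ≤ ((S * e) ^ 2 / 3) * (N * (e + S * e)) :=
      abs_mul_le_of_le (by rw [abs_of_nonneg (by positivity)]) hF₁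
    calc _ ≤ ((S * e) * (9 / 10)) * (e * (N * (S * e))) + ((S * e) ^ 2 / 3) * (N * (e + S * e)) :=
          (abs_add_le _ _).trans (add_le_add t1 t2)
      _ = N * (S * e) ^ 2 * (37 / 30 * e + (S * e) / 3) := by ring
  have hΛe : Λ * e ^ 2 = ρ ^ 2 * s₀ ^ 2 * δ := by
    have h1 : ρ ^ 2 * s₀ ^ 2 = Λ ^ 2 * e ^ 2 := by rw [← mul_pow, hρ, mul_pow]
    calc Λ * e ^ 2 = Λ ^ 2 * e ^ 2 * δ := by
          calc Λ * e ^ 2 = Λ * e ^ 2 * (δ * Λ) := by rw [hδΛ, mul_one]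
            _ = Λ ^ 2 * e ^ 2 * δ := by ring
      _ = ρ ^ 2 * s₀ ^ 2 * δ := by rw [← h1]
  have hPl : (S * e) ^ 2 - 4 * δ ^ 2 ≤ (S * e) ^ 2 - (1 - w) ^ 2 * e ^ 2 := by linarith
  exact inner_h2_arith hδ hδ' he hst1 hst2 hP hPl hs₀ (by linarith) hρ0 hN hΛe hρ hbr key


/-- **Registered helper `packingResolventW_innerCoeff` of `stub_packingResolventW`: THE FOUR COEFFICIENT BOUNDS OF THE
ACOUSTIC NORMAL FORM.** On `x ≤ x_Λ` (`Λ ≥ 1000`, `δ = 1/Λ`, atoms as in `inner_atoms_small`, `ρs₀ = Λeˣ`), any reals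
`a₁₁, a₁₂, a₂₁, a₂₂` obeying the characterisations of `inner_normal_form` satisfy `|a₁₁ + 3| ≤ 8δ`, `|a₁₂ − 3| ≤ δ/10`,
`|a₂₁ − ρ²/3| ≤ (2/3)ρ²δ`, `0 ≤ a₂₂ ≤ (9/10)ρ²δ` — the inner system is an `O(1/Λ)` perturbation of the forced
modified-spherical-Bessel system. [folklore] -/
theorem packingResolventW_innerCoeff : ∀ (Λ δ r w w' S S' e s₀ ρ a₁₁ a₁₂ a₂₁ a₂₂ : ℝ), δ * Λ = 1 → 0 < δ → δ ≤ 1 / 1000 → 0 < e → e ≤ 2 * δ → 7 / 10 ≤ s₀ → s₀ ≤ 1 → ρ * s₀ = Λ * e → 7 / 10 ≤ S * e → S * e ≤ 1 → |S * e - s₀| ≤ δ ^ 2 → |e * (S + S')| ≤ δ ^ 2 → |w - (r - 1)| ≤ δ ^ 2 → |w'| ≤ δ ^ 2 → 17307 / 15625 ≤ r → r ≤ 697 / 625 → a₁₁ * (S ^ 2 - (1 - w) ^ 2) = -3 * (2 * S + S') * S + (1 - w) * (Λ - (w' + 2 * w - r)) → a₁₂ * (Λ * e ^ 2 * S * (S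 ^ 2 - (1 - w) ^ 2)) = 3 * s₀ ^ 2 * (Λ * S + (w - 1) * (2 * S + S') - (w' / 3 + 2 * w - r) * S) → a₂₁ * (s₀ ^ 2 * (S ^ 2 - (1 - w) ^ 2)) = Λ * e ^ 2 * S * (Λ * S / 3 - (w' + 2 * w - r) * S / 3 - (1 - w) * (2 * S + S')) → a₂₂ * ((S ^ 2 - (1 - w) ^ 2) * S) = (1 - w) * (Λ * S + (w - 1) * (2 * S + S') - (w' / 3 + 2 * w - r) * S) → |a₁₁ + 3| ≤ 8 * δ ∧ |a₁₂ - 3| ≤ δ / 10 ∧ |a₂₁ - ρ ^ 2 / 3| ≤ 2 / 3 * ρ ^ 2 * δ ∧ 0 ≤ a₂₂ ∧ a₂₂ ≤ 9 / 10 * ρ ^ 2 * δ := by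
  intro Λ δ r w w' S S' e s₀ ρ a₁₁ a₁₂ a₂₁ a₂₂ hδΛ hδ hδ' he he2 hs₀ hs₀' hρ hst1 hst2 hst0 hsd hw hw' hr1 hr2
    ha11 ha12 ha21 ha22
  obtain ⟨h22a, h22b⟩ := inner_a22_bound hδΛ hδ hδ' he he2 hs₀ hρ hst1 hst2 hst0 hsd hw hw' hr1 hr2 ha22
  exact ⟨inner_a11_bound hδΛ hδ hδ' he he2 hst1 hst2 hsd hw hw' hr1 hr2 ha11,
    inner_a12_bound hδΛ hδ hδ' he he2 hs₀ hs₀' hst1 hst2 hst0 hsd hw hw' hr1 hr2 ha12,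
    inner_a21_bound hδΛ hδ hδ' he he2 hs₀ hρ hst1 hst2 hsd hw hw' hr1 hr2 ha21, h22a, h22b⟩

end Summit.AtomisticToContinuum.HydrodynamicLimit.Theorems.PackingAnalyticImplosion
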